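/-
Copyright (c) 2026 the pub-hodgecm-mathlib formalisation cell (harness21).  Prover seat hodgecm-mathlib-LH4-p07 (g8), req620 Track A «(D-RAM) FOUR-FRAME» squad
(STAGE-1b pre-scoping, heir LEAD F0P3a-plan (g20∕g21) T19-24 clause; dealer LH4-plan (g12∕g13) WORD #36 «p07 (g8): row-(2) lead»), 2026-09-04.
-/
import Summits.HodgeConjecture.HodgeConjecture.Theorems.F0P3cDyRamBlockCensusOrderFormJointProfile   -- ★ p859229 (this seat): (C1-P^{a,b}) the joint profile census, TWO-multiplier cells
import Summits.HodgeConjecture.HodgeConjecture.Theorems.F0P3cDyRamToricLevelCensusRamMTwoMult        -- ★ p858876∕p858944 (LH4-p04 (g6)): `finsum_mem_inter_levelSetDep_eq_ramified` — two-multiplier cells = [GUARD]·one-multiplier cells (M∕E RAMIFIED, `IsRamifiedQuadraticDatum`)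
import HarnessLib

/-!
# Crux `H413`, line LH4 «(D-RAM) FOUR-FRAME» — STAGE-1b, row (2): organ (C1-P^{a,b})_R «THE JOINT PROFILE CENSUS BEHIND THE TWO-MULTIPLIER GUARD, M∕E RAMIFIED (type RamM)»
# `#{L ∣ SD, Γ·L = L, (Γ−1)L ⊆ cL, (Γ−1)²L ⊆ c′L} = axis + Σ_{b=1}^{R} Σ_{j ≤ J} [lam, (lam−1)∕jE c, (lam−1)²∕jE c′ ∈ 𝒪_j]·[j + b ≤ m₂ ∨ |ρμ₁∕μ₁ − ρμ₂∕μ₂| ≤ exp(2m₂ − 2b − 2j − d_ρ)]·Σᶠ_{Λ ∈ levelSetDep(j,b;μ₁)} #Sol_{2b}(r_Λ)`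

Cell `hodgecm-mathlib` (D-0151), FLOOR 0, crux item H413 = `stmt-HodgeConjecture-24833`, route of record `HCCMUnconditional`; squad F0∕P3c∕LH4; lane
`--supports stmt-HodgeConjecture-24833 --as helper` (count-neutral; pays NO tier-0 row; the STAGE-1b rows `stub_rows_transvPlus ∕ transvMinus ∕ regular` stay OPEN).
THEOREMS ONLY (no `def`, no instance, no notation, no `sorry`).  Consumer: the STAGE-1b directive (heir LEAD F0P3a-plan, dealer LH4-plan), ROW (2) = TYPE-(2) POPULATION.

THE OBJECT.  ★ p859229 (this seat) put the `G`-side census of every unlabelled template piece `lev_{a,m} = K_{a,m} = 𝟙{X ∈ ϖ^a M₃, X² ∈ ϖ^m M₃}` (F0P3-p01 (g35) TEMPLATE-LAWS §1;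
★ p858649 §5) at `Γ = endoGL (γ₂, u)` into ORDER FORM with the TWO-multiplier cone cells `levelSetDep(j,b;μ₁) ∩ levelSetDep(j,b;μ₂)`,
`μ₁ = (jE c)⁻¹(lam − jE u₀₀)` (depth), `μ₂ = (jE c′)⁻¹((lam − 1)² − jE (u₀₀ − 1)²)` (square).  LH4-p04 (g6)'s ★ `finsum_mem_inter_levelSetDep_eq_ramified`
(`…ToricLevelCensusRamMTwoMult` ED. 2, M∕E RAMIFIED: `IsRamifiedQuadraticDatum ρ α d_ρ t_ρ` — `α` a uniformizer of `M`, `|α − ρα| = |α|^{d_ρ}` — and `|jE ϖ| = exp(−2)`) says that on every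
stratum the two-multiplier cell is the ONE-multiplier cell of the SHALLOWER multiplier behind the lattice-free guard `j + b ≤ m_deep ∨ |ρμ₁∕μ₁ − ρμ₂∕μ₂| ≤ exp(2m_deep − 2b − 2j − d_ρ)`
(`|μᵢ| = |jE ϖ|^{mᵢ}`; two ultrametric balls nested or disjoint).  Composing: the joint profile census is ★ (C1) p857559's ONE-multiplier order form with a GUARDED indicator — the
RamM twin of ★ (this seat) `…JointProfileCensusGuardedUnr`.
* `ncard_fixed_selfDual_endoGL_lev_sq_eq_orderForm_guarded_ramified` (`m₁ ≤ m₂`: the depth multiplier is the shallower; cells `levelSetDep(j,b;μ₁)`);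
* `ncard_fixed_selfDual_endoGL_lev_sq_eq_orderForm_guarded_ramified'` (`m₂ ≤ m₁`: the square multiplier is the shallower; cells `levelSetDep(j,b;μ₂)`).
The tokens `m₁, m₂` are BINDERS (`|μ₁| = |jE ϖ|^{m₁}`, `|μ₂| = |jE ϖ|^{m₂}`); the guard letter for the pair of record is ★ `…RamMTwoMult.v_twist_sub_twist_eq` (type-free).
HONEST LABEL.  Count-neutral lattice bookkeeping over ★ organs; nothing printed is asserted; no census law is stated; `HC_CM` is proved only modulo the 7 printed citations (2 remaining
named inputs: hLiu418 = `stmt-HodgeConjecture-24832`, h413 = `stmt-HodgeConjecture-24833`) until rung 0 closes.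

## References
* [Kottwitz1986BaseChangeUnits] R. E. Kottwitz, *Base change for unit elements of Hecke algebras*, Compositio Math. 60 (1986): §1 pp. 240–241.
* [Jacobowitz1962] R. Jacobowitz, *Hermitian forms over local fields*, Amer. J. Math. 84 (1962): §4.
* [Serre1979] J.-P. Serre, *Local Fields*, GTM 67 (1979): Ch. II §1 (the ultrametric inequality), Ch. III §6 Prop. 12 (orders of conductor `c`), Ch. IV §1 (ramification).
* [Flicker1998UnitaryFL] Y. Z. Flicker, *Elementary proof of the fundamental lemma for a unitary group*, Canad. J. Math. 50 (1998): Prop. 7 p. 84 (the level tables).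
-/

set_option autoImplicit false

noncomputable section

open scoped Valued WithZero Matrix MatrixGroups
open WithZero
open scoped Classical
open Literature.NumberTheory.Automorphic Literature.NumberTheory.Automorphic.HermitianLattice Literature.NumberTheory.Automorphic.UnitaryLatticeTree
open Literature.NumberTheory.Rogawski1990
open Literature.NumberTheory.Automorphic.EllipticPlaneAsFieldLine
open Literature.NumberTheory.Automorphic.UnitaryThreeFourFrame (IsRamifiedQuadraticDatum)
open Literature.NumberTheory.LocalFields.QuadraticOrder
open Summit.HodgeConjecture.HodgeConjecture.Cruxes.H413.F0P3cDyRamToricCensusDefs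
open Summit.HodgeConjecture.HodgeConjecture.Cruxes.H413.F0P3cDyRamWSideOrderCensus
open Summit.HodgeConjecture.HodgeConjecture.Cruxes.H413.F0P3cDyRamConeLevelTransport
open Summit.HodgeConjecture.HodgeConjecture.Cruxes.H413.F0P3cDyRamBlockGlueCount
open Summit.HodgeConjecture.HodgeConjecture.Cruxes.H413.F0P3cDyRamBlockGluePlane
open Summit.HodgeConjecture.HodgeConjecture.Cruxes.H413.F0P3cDyRamBlockCensusOrderForm
open Summit.HodgeConjecture.HodgeConjecture.Cruxes.H413.F0P3cDyRamBlockCensusOrderFormJointProfile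
open Summit.HodgeConjecture.HodgeConjecture.Cruxes.H413.F0P3cDyRamToricLevelCensusRamMTwoMult

namespace Summit.HodgeConjecture.HodgeConjecture.Cruxes.H413.F0P3cDyRamJointProfileCensusGuardedRamM

-- `M : Type` (not `Type*`): ★ `IsRamifiedQuadraticDatum` is stated in universe `0`.
variable {E : Type*} {M : Type} [Field E] [Valued E ℤᵐ⁰] [Field M] [Valued M ℤᵐ⁰] {ρ Θ : M →+* M} {α : M}

/-- **(C1-P^{a,b})_R THE JOINT PROFILE CENSUS BEHIND THE GUARD, M∕E RAMIFIED — the depth multiplier shallower (`m₁ ≤ m₂`).**  Frame of ★ p859229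
`ncard_fixed_selfDual_endoGL_lev_sq_eq_orderForm` VERBATIM, plus the ramified datum `IsRamifiedQuadraticDatum ρ α d_ρ t_ρ`, `|jE ϖ| = exp(−2)` and the multiplier tokens
`|μ₁| = |jE ϖ|^{m₁}`, `|μ₂| = |jE ϖ|^{m₂}`, `m₁ ≤ m₂` (`μ₁ = (jE c)⁻¹(lam − jE u₀₀)`, `μ₂ = (jE c′)⁻¹((lam − 1)² − jE (u₀₀ − 1)²)`).  Then the cone term has ONE-multiplier cells:
`Σ_{b ∈ Icc 1 R} Σ_{j<J+1} [IsOrd_j lam ∧ IsOrd_j ((jE c)⁻¹(lam−1)) ∧ IsOrd_j ((jE c′)⁻¹(lam−1)²)]·[j + b ≤ m₂ ∨ |ρμ₁∕μ₁ − ρμ₂∕μ₂| ≤ exp(2m₂ − 2b − 2j − d_ρ)]·Σᶠ_{Λ ∈ levelSetDep(j,b;μ₁)} f b j Λ`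
— ★ p859229 ∘ ★ p858944 `finsum_mem_inter_levelSetDep_eq_ramified` cell by cell. [cite: Kottwitz1986BaseChangeUnits, §1 pp. 240–241] [cite: Jacobowitz1962, §4] [cite: Serre1979, Ch. II §1; Ch. IV §1] [cite: Flicker1998UnitaryFL, Prop. 7 p. 84] -/
theorem ncard_fixed_selfDual_endoGL_lev_sq_eq_orderForm_guarded_ramified [IsPrincipalIdealRing 𝒪[E]] (σ : E →+* E) (hσ : ∀ a, σ (σ a) = a) (hvσ : ∀ a, Valued.v (σ a) = Valued.v a)
    {ϖ : E} (hϖ : Valued.v ϖ = WithZero.exp (-1 : ℤ))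
    {H₂ : Matrix (Fin 2) (Fin 2) E} (hH₂ : IsUnit H₂.det) (hH₂σ : (H₂.map σ)ᵀ = H₂) {hW : E} (hhW : Valued.v hW = 1) (hhWσ : σ hW = hW) (jE : E →+* M)
    (hρρ : ∀ x, ρ (ρ x) = x) (hvρ : ∀ x, Valued.v (ρ x) = Valued.v x) (hα : ρ α ≠ α) (hα1 : Valued.v α ≤ 1)
    (hint : ∀ z : M, Valued.v z ≤ 1 → Valued.v ((z - ρ z) / (α - ρ α)) ≤ 1)
    (hΘΘ : ∀ x, Θ (Θ x) = x) (hΘρ : ∀ x, Θ (ρ x) = ρ (Θ x)) (hvΘ : ∀ x, Valued.v (Θ x) = Valued.v x) (hΘj : ∀ x, Θ (jE x) = jE (σ x))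
    (hjv : ∀ c, Valued.v (jE c) ≤ 1 ↔ Valued.v c ≤ 1) (hjfix : ∀ z, ρ z = z ↔ ∃ c, jE c = z)
    (hjpow : ∀ (t : E) (n : ℤ), Valued.v (jE t) = Valued.v (jE ϖ) ^ n ↔ Valued.v t = Valued.v ϖ ^ n)
    (hEval : ∀ c : M, ρ c = c → c ≠ 0 → Valued.v c ≤ 1 → ∃ n : ℕ, Valued.v c = Valued.v (jE ϖ) ^ n)
    (hϖmax : ∀ t : M, ρ t = t → Valued.v t < 1 → Valued.v t ≤ Valued.v (jE ϖ))
    (φ : (Fin 2 → E) →+ M) (hφs : ∀ (c : E) (x : Fin 2 → E), φ (c • x) = jE c * φ x) (hφi : Function.Injective φ) (hφo : Function.Surjective φ)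
    {γ₂ : GL (Fin 2) E} {lam h : M} (hφγ : ∀ x, φ ((γ₂ : Matrix (Fin 2) (Fin 2) E).mulVec x) = lam * φ x) (hlam : Valued.v lam = 1)
    (hΘh : Θ h = h) (hh : h ≠ 0) (hform : ∀ x y, jE (pairing σ H₂ x y) = h * Θ (φ x) * φ y + ρ (h * Θ (φ x) * φ y))
    (u : GL (Fin 1) E) (hΓ : endoGL (γ₂, u) ∈ unitaryGroupOfForm σ (!![H₂ 0 0, 0, H₂ 0 1; 0, hW, 0; H₂ 1 0, 0, H₂ 1 1] : Matrix (Fin 3) (Fin 3) E))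
    (hu : Valued.v ((u : Matrix (Fin 1) (Fin 1) E) 0 0) = 1) {c c' : E} (hc : c ≠ 0) (hc' : c' ≠ 0) (hc1 : Valued.v c ≤ 1)
    (huc : Valued.v ((u : Matrix (Fin 1) (Fin 1) E) 0 0 - 1) ≤ Valued.v c) (huc2 : Valued.v (((u : Matrix (Fin 1) (Fin 1) E) 0 0 - 1) ^ 2) ≤ Valued.v c')
    {dρ tρ : ℕ} (hD : IsRamifiedQuadraticDatum ρ α dρ tρ) (hϖM : Valued.v (jE ϖ) = WithZero.exp (-2 : ℤ)) {m₁ m₂ : ℕ}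
    (hm₁ : Valued.v ((jE c)⁻¹ * (lam - jE ((u : Matrix (Fin 1) (Fin 1) E) 0 0))) = Valued.v (jE ϖ) ^ m₁)
    (hm₂ : Valued.v ((jE c')⁻¹ * ((lam - 1) * (lam - 1) - jE (((u : Matrix (Fin 1) (Fin 1) E) 0 0 - 1) ^ 2))) = Valued.v (jE ϖ) ^ m₂) (hle : m₁ ≤ m₂) {R : ℕ}
    (hfinF : {L : Submodule 𝒪[E] (Fin 3 → E) |
      IsSelfDualLattice σ ϖ (!![H₂ 0 0, 0, H₂ 0 1; 0, hW, 0; H₂ 1 0, 0, H₂ 1 1] : Matrix (Fin 3) (Fin 3) E) L ∧ mapGL (endoGL (γ₂, u)) L = L}.Finite)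
    (hR : ∀ L : Submodule 𝒪[E] (Fin 3 → E), IsSelfDualLattice σ ϖ (!![H₂ 0 0, 0, H₂ 0 1; 0, hW, 0; H₂ 1 0, 0, H₂ 1 1] : Matrix (Fin 3) (Fin 3) E) L →
      mapGL (endoGL (γ₂, u)) L = L → ∀ b : ℕ, (∀ c : E, (Pi.single 1 c : Fin 3 → E) ∈ L ↔ Valued.v c ≤ Valued.v ϖ ^ b) → b ≤ R)
    {J : ℕ} (hJ : ¬ IsOrd ρ α (jE ϖ ^ (J + 1)) lam) (hfinLS : ∀ j a, (levelSet ρ Θ α (jE ϖ) h j a).Finite)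
    (f : ℕ → ℕ → AddSubgroup M → ℕ)
    (hf : ∀ (b j : ℕ) (Λ : AddSubgroup M) (x₀ : M) (r : E), 1 ≤ b → x₀ ≠ 0 →
      (∀ x, x ∈ Λ ↔ ∃ z, IsOrd ρ α (jE ϖ ^ j) z ∧ x = x₀ * z) →
      IsOrd ρ α (jE ϖ ^ j) (dualGen ρ Θ α (jE ϖ ^ j) h x₀) → ¬ IsOrd ρ α (jE ϖ ^ j) (dualGen ρ Θ α (jE ϖ ^ j) h x₀ / jE ϖ) →
      Valued.v (dualGen ρ Θ α (jE ϖ ^ j) h x₀) = Valued.v (jE ϖ) ^ b →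
      (∀ b', (∀ x ∈ Λ, Valued.v (h * Θ x * b' + ρ (h * Θ x * b')) ≤ 1) → (lam - jE ((u : Matrix (Fin 1) (Fin 1) E) 0 0)) * b' ∈ Λ) →
      IsOrd ρ α (jE ϖ ^ j) lam → jE r = glueUnit ρ Θ α (jE ϖ ^ j) h (jE ϖ) (jE hW) x₀ b →
      f b j Λ = Nat.card {x : 𝒪[E] ⧸ 𝓂[E] ^ (2 * b) // ∃ u' : 𝒪[E], Ideal.Quotient.mk (𝓂[E] ^ (2 * b)) u' = x ∧
        Valued.v ((u' : E) * σ u' - r) ≤ Valued.v (ϖ ^ (2 * b))}) :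
    {L : Submodule 𝒪[E] (Fin 3 → E) |
        IsSelfDualLattice σ ϖ (!![H₂ 0 0, 0, H₂ 0 1; 0, hW, 0; H₂ 1 0, 0, H₂ 1 1] : Matrix (Fin 3) (Fin 3) E) L ∧ mapGL (endoGL (γ₂, u)) L = L ∧
          L.map ((Matrix.toLin' (((endoGL (γ₂, u) : GL (Fin 3) E) : Matrix (Fin 3) (Fin 3) E) - 1)).restrictScalars 𝒪[E]) ≤ scaleLattice c L ∧
          L.map ((Matrix.toLin' ((((endoGL (γ₂, u) : GL (Fin 3) E) : Matrix (Fin 3) (Fin 3) E) - 1) *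
            (((endoGL (γ₂, u) : GL (Fin 3) E) : Matrix (Fin 3) (Fin 3) E) - 1))).restrictScalars 𝒪[E]) ≤ scaleLattice c' L}.ncard =
      (∑ j ∈ Finset.range (J + 1), (if IsOrd ρ α (jE ϖ ^ j) lam ∧ IsOrd ρ α (jE ϖ ^ j) ((jE c)⁻¹ * (lam - 1)) ∧
          IsOrd ρ α (jE ϖ ^ j) ((jE c')⁻¹ * ((lam - 1) * (lam - 1))) then (levelSet ρ Θ α (jE ϖ) h j 0).ncard else 0)) +
        ∑ b ∈ Finset.Icc 1 R, ∑ j ∈ Finset.range (J + 1), (if IsOrd ρ α (jE ϖ ^ j) lam ∧ IsOrd ρ α (jE ϖ ^ j) ((jE c)⁻¹ * (lam - 1)) ∧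
            IsOrd ρ α (jE ϖ ^ j) ((jE c')⁻¹ * ((lam - 1) * (lam - 1))) then
          (if j + b ≤ m₂ ∨ Valued.v (ρ ((jE c)⁻¹ * (lam - jE ((u : Matrix (Fin 1) (Fin 1) E) 0 0))) / ((jE c)⁻¹ * (lam - jE ((u : Matrix (Fin 1) (Fin 1) E) 0 0))) - ρ ((jE c')⁻¹ * ((lam - 1) * (lam - 1) - jE (((u : Matrix (Fin 1) (Fin 1) E) 0 0 - 1) ^ 2))) / ((jE c')⁻¹ * ((lam - 1) * (lam - 1) - jE (((u : Matrix (Fin 1) (Fin 1) E) 0 0 - 1) ^ 2)))) ≤ WithZero.exp (2 * (m₂ : ℤ) - 2 * b - 2 * j - dρ) then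
            ∑ᶠ Λ ∈ levelSetDep ρ Θ α (jE ϖ) h j b ((jE c)⁻¹ * (lam - jE ((u : Matrix (Fin 1) (Fin 1) E) 0 0))), f b j Λ else 0) else 0) := by
  have hρϖ : ρ (jE ϖ) = jE ϖ := (hjfix _).2 ⟨ϖ, rfl⟩
  rw [ncard_fixed_selfDual_endoGL_lev_sq_eq_orderForm σ hσ hvσ hϖ hH₂ hH₂σ hhW hhWσ jE hρρ hvρ hα hα1 hint hΘΘ hΘρ hvΘ hΘj hjv hjfix hjpow hEval hϖmax φ hφs hφi hφo hφγ hlam hΘh hh hform u hΓ hu hc hc' hc1 huc huc2 hfinF hR hJ hfinLS f hf]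
  congr 1
  refine Finset.sum_congr rfl fun b _ => Finset.sum_congr rfl fun j _ => ?_
  by_cases h3 : IsOrd ρ α (jE ϖ ^ j) lam ∧ IsOrd ρ α (jE ϖ ^ j) ((jE c)⁻¹ * (lam - 1)) ∧ IsOrd ρ α (jE ϖ ^ j) ((jE c')⁻¹ * ((lam - 1) * (lam - 1)))
  · rw [if_pos h3, if_pos h3]
    exact finsum_mem_inter_levelSetDep_eq_ramified hD hΘΘ hΘρ hvΘ hρϖ hϖM hh hm₁ hm₂ hle j b (f b j)
  · rw [if_neg h3, if_neg h3]

/-- **(C1-P^{a,b})_R THE JOINT PROFILE CENSUS BEHIND THE GUARD, M∕E RAMIFIED — the square multiplier shallower (`m₂ ≤ m₁`).**  As `…_guarded_ramified` with the roles of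
`μ₁ = (jE c)⁻¹(lam − jE u₀₀)` and `μ₂ = (jE c′)⁻¹((lam − 1)² − jE (u₀₀ − 1)²)` exchanged: cells `levelSetDep(j,b;μ₂)` behind `[j + b ≤ m₁ ∨ |ρμ₂∕μ₂ − ρμ₁∕μ₁| ≤ exp(2m₁ − 2b − 2j − d_ρ)]`
(`Set.inter_comm` ∘ ★ p858944). [cite: Kottwitz1986BaseChangeUnits, §1 pp. 240–241] [cite: Jacobowitz1962, §4] [cite: Serre1979, Ch. II §1; Ch. IV §1] [cite: Flicker1998UnitaryFL, Prop. 7 p. 84] -/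
theorem ncard_fixed_selfDual_endoGL_lev_sq_eq_orderForm_guarded_ramified' [IsPrincipalIdealRing 𝒪[E]] (σ : E →+* E) (hσ : ∀ a, σ (σ a) = a) (hvσ : ∀ a, Valued.v (σ a) = Valued.v a)
    {ϖ : E} (hϖ : Valued.v ϖ = WithZero.exp (-1 : ℤ))
    {H₂ : Matrix (Fin 2) (Fin 2) E} (hH₂ : IsUnit H₂.det) (hH₂σ : (H₂.map σ)ᵀ = H₂) {hW : E} (hhW : Valued.v hW = 1) (hhWσ : σ hW = hW) (jE : E →+* M)
    (hρρ : ∀ x, ρ (ρ x) = x) (hvρ : ∀ x, Valued.v (ρ x) = Valued.v x) (hα : ρ α ≠ α) (hα1 : Valued.v α ≤ 1)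
    (hint : ∀ z : M, Valued.v z ≤ 1 → Valued.v ((z - ρ z) / (α - ρ α)) ≤ 1)
    (hΘΘ : ∀ x, Θ (Θ x) = x) (hΘρ : ∀ x, Θ (ρ x) = ρ (Θ x)) (hvΘ : ∀ x, Valued.v (Θ x) = Valued.v x) (hΘj : ∀ x, Θ (jE x) = jE (σ x))
    (hjv : ∀ c, Valued.v (jE c) ≤ 1 ↔ Valued.v c ≤ 1) (hjfix : ∀ z, ρ z = z ↔ ∃ c, jE c = z)
    (hjpow : ∀ (t : E) (n : ℤ), Valued.v (jE t) = Valued.v (jE ϖ) ^ n ↔ Valued.v t = Valued.v ϖ ^ n)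
    (hEval : ∀ c : M, ρ c = c → c ≠ 0 → Valued.v c ≤ 1 → ∃ n : ℕ, Valued.v c = Valued.v (jE ϖ) ^ n)
    (hϖmax : ∀ t : M, ρ t = t → Valued.v t < 1 → Valued.v t ≤ Valued.v (jE ϖ))
    (φ : (Fin 2 → E) →+ M) (hφs : ∀ (c : E) (x : Fin 2 → E), φ (c • x) = jE c * φ x) (hφi : Function.Injective φ) (hφo : Function.Surjective φ)
    {γ₂ : GL (Fin 2) E} {lam h : M} (hφγ : ∀ x, φ ((γ₂ : Matrix (Fin 2) (Fin 2) E).mulVec x) = lam * φ x) (hlam : Valued.v lam = 1)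
    (hΘh : Θ h = h) (hh : h ≠ 0) (hform : ∀ x y, jE (pairing σ H₂ x y) = h * Θ (φ x) * φ y + ρ (h * Θ (φ x) * φ y))
    (u : GL (Fin 1) E) (hΓ : endoGL (γ₂, u) ∈ unitaryGroupOfForm σ (!![H₂ 0 0, 0, H₂ 0 1; 0, hW, 0; H₂ 1 0, 0, H₂ 1 1] : Matrix (Fin 3) (Fin 3) E))
    (hu : Valued.v ((u : Matrix (Fin 1) (Fin 1) E) 0 0) = 1) {c c' : E} (hc : c ≠ 0) (hc' : c' ≠ 0) (hc1 : Valued.v c ≤ 1)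
    (huc : Valued.v ((u : Matrix (Fin 1) (Fin 1) E) 0 0 - 1) ≤ Valued.v c) (huc2 : Valued.v (((u : Matrix (Fin 1) (Fin 1) E) 0 0 - 1) ^ 2) ≤ Valued.v c')
    {dρ tρ : ℕ} (hD : IsRamifiedQuadraticDatum ρ α dρ tρ) (hϖM : Valued.v (jE ϖ) = WithZero.exp (-2 : ℤ)) {m₁ m₂ : ℕ}
    (hm₁ : Valued.v ((jE c)⁻¹ * (lam - jE ((u : Matrix (Fin 1) (Fin 1) E) 0 0))) = Valued.v (jE ϖ) ^ m₁)
    (hm₂ : Valued.v ((jE c')⁻¹ * ((lam - 1) * (lam - 1) - jE (((u : Matrix (Fin 1) (Fin 1) E) 0 0 - 1) ^ 2))) = Valued.v (jE ϖ) ^ m₂) (hle : m₂ ≤ m₁) {R : ℕ}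
    (hfinF : {L : Submodule 𝒪[E] (Fin 3 → E) |
      IsSelfDualLattice σ ϖ (!![H₂ 0 0, 0, H₂ 0 1; 0, hW, 0; H₂ 1 0, 0, H₂ 1 1] : Matrix (Fin 3) (Fin 3) E) L ∧ mapGL (endoGL (γ₂, u)) L = L}.Finite)
    (hR : ∀ L : Submodule 𝒪[E] (Fin 3 → E), IsSelfDualLattice σ ϖ (!![H₂ 0 0, 0, H₂ 0 1; 0, hW, 0; H₂ 1 0, 0, H₂ 1 1] : Matrix (Fin 3) (Fin 3) E) L →
      mapGL (endoGL (γ₂, u)) L = L → ∀ b : ℕ, (∀ c : E, (Pi.single 1 c : Fin 3 → E) ∈ L ↔ Valued.v c ≤ Valued.v ϖ ^ b) → b ≤ R)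
    {J : ℕ} (hJ : ¬ IsOrd ρ α (jE ϖ ^ (J + 1)) lam) (hfinLS : ∀ j a, (levelSet ρ Θ α (jE ϖ) h j a).Finite)
    (f : ℕ → ℕ → AddSubgroup M → ℕ)
    (hf : ∀ (b j : ℕ) (Λ : AddSubgroup M) (x₀ : M) (r : E), 1 ≤ b → x₀ ≠ 0 →
      (∀ x, x ∈ Λ ↔ ∃ z, IsOrd ρ α (jE ϖ ^ j) z ∧ x = x₀ * z) →
      IsOrd ρ α (jE ϖ ^ j) (dualGen ρ Θ α (jE ϖ ^ j) h x₀) → ¬ IsOrd ρ α (jE ϖ ^ j) (dualGen ρ Θ α (jE ϖ ^ j) h x₀ / jE ϖ) →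
      Valued.v (dualGen ρ Θ α (jE ϖ ^ j) h x₀) = Valued.v (jE ϖ) ^ b →
      (∀ b', (∀ x ∈ Λ, Valued.v (h * Θ x * b' + ρ (h * Θ x * b')) ≤ 1) → (lam - jE ((u : Matrix (Fin 1) (Fin 1) E) 0 0)) * b' ∈ Λ) →
      IsOrd ρ α (jE ϖ ^ j) lam → jE r = glueUnit ρ Θ α (jE ϖ ^ j) h (jE ϖ) (jE hW) x₀ b →
      f b j Λ = Nat.card {x : 𝒪[E] ⧸ 𝓂[E] ^ (2 * b) // ∃ u' : 𝒪[E], Ideal.Quotient.mk (𝓂[E] ^ (2 * b)) u' = x ∧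
        Valued.v ((u' : E) * σ u' - r) ≤ Valued.v (ϖ ^ (2 * b))}) :
    {L : Submodule 𝒪[E] (Fin 3 → E) |
        IsSelfDualLattice σ ϖ (!![H₂ 0 0, 0, H₂ 0 1; 0, hW, 0; H₂ 1 0, 0, H₂ 1 1] : Matrix (Fin 3) (Fin 3) E) L ∧ mapGL (endoGL (γ₂, u)) L = L ∧
          L.map ((Matrix.toLin' (((endoGL (γ₂, u) : GL (Fin 3) E) : Matrix (Fin 3) (Fin 3) E) - 1)).restrictScalars 𝒪[E]) ≤ scaleLattice c L ∧
          L.map ((Matrix.toLin' ((((endoGL (γ₂, u) : GL (Fin 3) E) : Matrix (Fin 3) (Fin 3) E) - 1) *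
            (((endoGL (γ₂, u) : GL (Fin 3) E) : Matrix (Fin 3) (Fin 3) E) - 1))).restrictScalars 𝒪[E]) ≤ scaleLattice c' L}.ncard =
      (∑ j ∈ Finset.range (J + 1), (if IsOrd ρ α (jE ϖ ^ j) lam ∧ IsOrd ρ α (jE ϖ ^ j) ((jE c)⁻¹ * (lam - 1)) ∧
          IsOrd ρ α (jE ϖ ^ j) ((jE c')⁻¹ * ((lam - 1) * (lam - 1))) then (levelSet ρ Θ α (jE ϖ) h j 0).ncard else 0)) +
        ∑ b ∈ Finset.Icc 1 R, ∑ j ∈ Finset.range (J + 1), (if IsOrd ρ α (jE ϖ ^ j) lam ∧ IsOrd ρ α (jE ϖ ^ j) ((jE c)⁻¹ * (lam - 1)) ∧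
            IsOrd ρ α (jE ϖ ^ j) ((jE c')⁻¹ * ((lam - 1) * (lam - 1))) then
          (if j + b ≤ m₁ ∨ Valued.v (ρ ((jE c')⁻¹ * ((lam - 1) * (lam - 1) - jE (((u : Matrix (Fin 1) (Fin 1) E) 0 0 - 1) ^ 2))) / ((jE c')⁻¹ * ((lam - 1) * (lam - 1) - jE (((u : Matrix (Fin 1) (Fin 1) E) 0 0 - 1) ^ 2))) - ρ ((jE c)⁻¹ * (lam - jE ((u : Matrix (Fin 1) (Fin 1) E) 0 0))) / ((jE c)⁻¹ * (lam - jE ((u : Matrix (Fin 1) (Fin 1) E) 0 0)))) ≤ WithZero.exp (2 * (m₁ : ℤ) - 2 * b - 2 * j - dρ) then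
            ∑ᶠ Λ ∈ levelSetDep ρ Θ α (jE ϖ) h j b ((jE c')⁻¹ * ((lam - 1) * (lam - 1) - jE (((u : Matrix (Fin 1) (Fin 1) E) 0 0 - 1) ^ 2))), f b j Λ else 0) else 0) := by
  have hρϖ : ρ (jE ϖ) = jE ϖ := (hjfix _).2 ⟨ϖ, rfl⟩
  rw [ncard_fixed_selfDual_endoGL_lev_sq_eq_orderForm σ hσ hvσ hϖ hH₂ hH₂σ hhW hhWσ jE hρρ hvρ hα hα1 hint hΘΘ hΘρ hvΘ hΘj hjv hjfix hjpow hEval hϖmax φ hφs hφi hφo hφγ hlam hΘh hh hform u hΓ hu hc hc' hc1 huc huc2 hfinF hR hJ hfinLS f hf]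
  congr 1
  refine Finset.sum_congr rfl fun b _ => Finset.sum_congr rfl fun j _ => ?_
  by_cases h3 : IsOrd ρ α (jE ϖ ^ j) lam ∧ IsOrd ρ α (jE ϖ ^ j) ((jE c)⁻¹ * (lam - 1)) ∧ IsOrd ρ α (jE ϖ ^ j) ((jE c')⁻¹ * ((lam - 1) * (lam - 1)))
  · rw [if_pos h3, if_pos h3, Set.inter_comm]
    exact finsum_mem_inter_levelSetDep_eq_ramified hD hΘΘ hΘρ hvΘ hρϖ hϖM hh hm₂ hm₁ hle j b (f b j)
  · rw [if_neg h3, if_neg h3]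

end Summit.HodgeConjecture.HodgeConjecture.Cruxes.H413.F0P3cDyRamJointProfileCensusGuardedRamM

end
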